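import Mathlib
import HarnessLib
import Summits.Ventures.LatticeQCDFlow.Exactness.IMHReversibleFlowProposals
import Summits.Ventures.LatticeQCDFlow.Exactness.RefreshScan

/-!
# LatticeQCDFlow / Exactness — KEEP A FRACTION OF FRESH FLOW DRAWS: mixing an independent flow proposal (weight `p`) into any
# `q`-reversible correlated proposal stays exact with the plain ratio AND retains the global Doeblin rate `p/W`

HONEST FRAMING: exact (Metropolis-corrected) sampling algorithms for lattice gauge theory;
figures of merit are autocorrelation/cost numbers at stated couplings and volumes; no
continuum-physics claim.

Venture `LatticeQCDFlow` (cell pub-lqcd), topic `Exactness`, FANOUT row 30 (lean-1 GEN-43, part II: MOVES IN FLOW SPACE; sequel of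
`IMHReversibleFlowProposals`).  NEW WORK of the cell; no definition is introduced, nothing is cited as a fact.  Tree inputs:
`IMHReversibleFlowProposals` (`revProposal_isReversible`, `revProposal_isMarkovKernel`), `IMHKernel` (`imhAcceptE_ge_of_le`), `RefreshScan`
(`uniformlyErgodic_of_minorised`).  Printed counterparts NAMED ONLY: defensive ∕ mixture proposals (Hesterberg 1995; Tierney 1994 §2.4);
the tree's `IMHDefensiveMixtureCertificate` mixes two INDEPENDENCE proposals — here one component is an arbitrary correlated move.

## Setting (general measurable `Ω`; flow law `q`; weight `w > 0`; `π = w·q`; `R` a Markov kernel reversible for `q`; `p ∈ [0, 1]`)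

THE DEFENSIVE PROPOSAL, def-free: ANY kernel `R'` with `R'(x, B) = p·q(B) + (1 − p)·R(x, B)` — with probability `p` a fresh flow draw,
else the correlated move.  The sampler: ANY `K` with `K(x, B) = ∫_B a(x, y) R'(x, dy) + (1 − ∫ a dR'(x))·1_B(x)`, `a = min(1, w(y)/w(x))`.

## Results [all ours]

* `defensive_isReversible_flow`: `R'` is reversible for `q` (reversibility is linear; the fresh draw is reversible); `defensive_isMarkovKernel`.
* **`defensive_invariant`**: `π` is invariant under `K` (`revProposal_invariant`).
* `defensive_apply_ge`: `K(x, B) ≥ p·∫_B a(x, y) q(dy)` for every `B`; hence for `0 < w ≤ M`: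
  **`defensive_minorisation`**: `K(x, B) ≥ (p/M)·π(B)` from EVERY `x` — Doeblin with constant `p/M`; and for a normalised weight `0 < w ≤ W`:
  **`defensive_uniformlyErgodic`**: `|μ₀Kᵗ(A) − π(A)| ≤ (1 − p/W)ᵗ` from every initial law.
A purely local `R` has no such constant; a fraction `p` of global flow draws buys back the independence sampler's rate, scaled by `p`,
while the correlated moves work between the global jumps — all under one accept/reject test.
-/

namespace Summit.Ventures.LatticeQCDFlow.Exactness

open MeasureTheory ProbabilityTheory
open scoped ENNReal

variable {Ω : Type*} [MeasurableSpace Ω] {q : Measure Ω} [IsProbabilityMeasure q] {w : Ω → ℝ} {p : ℝ≥0∞}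

/-! ## §1 The defensive proposal is `q`-reversible and Markov -/

omit [IsProbabilityMeasure q] in
/-- **Reversibility is linear**: `R'(x, B) = p·q(B) + (1 − p)·R(x, B)` is reversible for `q` when `R` is. [ours] -/
theorem defensive_isReversible_flow (R : Kernel Ω Ω) (hR : Kernel.IsReversible R q) (R' : Kernel Ω Ω)
    (hR' : ∀ (x : Ω) {B : Set Ω}, MeasurableSet B → R' x B = p * q B + (1 - p) * R x B) :
    Kernel.IsReversible R' q := by
  intro A B hA hB
  have hmA : Measurable fun x => (1 - p) * R x A := (Kernel.measurable_coe R hA).const_mul _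
  have hmB : Measurable fun x => (1 - p) * R x B := (Kernel.measurable_coe R hB).const_mul _
  simp_rw [hR' _ hB, hR' _ hA]
  rw [lintegral_add_left measurable_const, lintegral_add_left measurable_const, setLIntegral_const, setLIntegral_const,
    lintegral_const_mul _ (Kernel.measurable_coe R hB), lintegral_const_mul _ (Kernel.measurable_coe R hA), hR hA hB,
    mul_right_comm]

/-- `R'` is Markov when `p ≤ 1`. [ours, bookkeeping] -/
theorem defensive_isMarkovKernel (hp : p ≤ 1) (R : Kernel Ω Ω) [IsMarkovKernel R] (R' : Kernel Ω Ω)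
    (hR' : ∀ (x : Ω) {B : Set Ω}, MeasurableSet B → R' x B = p * q B + (1 - p) * R x B) : IsMarkovKernel R' :=
  ⟨fun x => ⟨by rw [hR' x MeasurableSet.univ, measure_univ, measure_univ, mul_one, mul_one, add_tsub_cancel_of_le hp]⟩⟩

/-! ## §2 Exactness -/

/-- **THE DEFENSIVE CORRELATED FLOW SAMPLER IS EXACT**: `π = w·q` is invariant. [ours] -/
theorem defensive_invariant (hw : Measurable w) (hw0 : ∀ x, 0 < w x) (hp : p ≤ 1) (R : Kernel Ω Ω) [IsMarkovKernel R]
    (hR : Kernel.IsReversible R q) (R' : Kernel Ω Ω)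
    (hR' : ∀ (x : Ω) {B : Set Ω}, MeasurableSet B → R' x B = p * q B + (1 - p) * R x B) (K : Kernel Ω Ω)
    (hK : ∀ (x : Ω) {B : Set Ω}, MeasurableSet B → K x B =
      ∫⁻ y in B, imhAcceptE w x y ∂(R' x) + (1 - ∫⁻ y, imhAcceptE w x y ∂(R' x)) * B.indicator 1 x) :
    Kernel.Invariant K (q.withDensity fun x => ENNReal.ofReal (w x)) := by
  haveI := defensive_isMarkovKernel hp R R' hR'
  exact revProposal_invariant hw hw0 R' (defensive_isReversible_flow R hR R' hR') K hK

/-! ## §3 The retained global rate -/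

omit [IsProbabilityMeasure q] in
/-- Integration against `R'(x, ·)` splits: `∫_B f dR'(x) = p·∫_B f dq + (1 − p)·∫_B f dR(x)`. [ours, bookkeeping] -/
theorem setLIntegral_defensive (R : Kernel Ω Ω) (R' : Kernel Ω Ω)
    (hR' : ∀ (x : Ω) {B : Set Ω}, MeasurableSet B → R' x B = p * q B + (1 - p) * R x B) (x : Ω) (f : Ω → ℝ≥0∞)
    (B : Set Ω) :
    ∫⁻ y in B, f y ∂(R' x) = p * ∫⁻ y in B, f y ∂q + (1 - p) * ∫⁻ y in B, f y ∂(R x) := by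
  have hR'x : R' x = p • q + (1 - p) • R x := by
    ext C hC
    rw [hR' x hC, Measure.add_apply, Measure.smul_apply, Measure.smul_apply, smul_eq_mul, smul_eq_mul]
  rw [hR'x, Measure.restrict_add, Measure.restrict_smul, Measure.restrict_smul, lintegral_add_measure,
    lintegral_smul_measure, lintegral_smul_measure, smul_eq_mul, smul_eq_mul]

omit [IsProbabilityMeasure q] in
/-- **`K(x, B) ≥ p·∫_B a(x, y) q(dy)`** — the fresh-draw component is a floor for every set. [ours] -/
theorem defensive_apply_ge (R : Kernel Ω Ω) (R' : Kernel Ω Ω)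
    (hR' : ∀ (x : Ω) {B : Set Ω}, MeasurableSet B → R' x B = p * q B + (1 - p) * R x B) (K : Kernel Ω Ω)
    (hK : ∀ (x : Ω) {B : Set Ω}, MeasurableSet B → K x B =
      ∫⁻ y in B, imhAcceptE w x y ∂(R' x) + (1 - ∫⁻ y, imhAcceptE w x y ∂(R' x)) * B.indicator 1 x)
    (x : Ω) {B : Set Ω} (hB : MeasurableSet B) :
    p * ∫⁻ y in B, imhAcceptE w x y ∂q ≤ K x B := by
  rw [hK x hB, setLIntegral_defensive R R' hR' x _ B, add_assoc]
  exact le_self_add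

omit [IsProbabilityMeasure q] in
/-- **DOEBLIN WITH CONSTANT `p/M`**: if `0 < w ≤ M` then `K(x, B) ≥ p·M⁻¹·π(B)` from every state. [ours] -/
theorem defensive_minorisation (hw : Measurable w) {M : ℝ} (hw0 : ∀ x, 0 < w x) (hM : ∀ x, w x ≤ M) (R : Kernel Ω Ω)
    (R' : Kernel Ω Ω) (hR' : ∀ (x : Ω) {B : Set Ω}, MeasurableSet B → R' x B = p * q B + (1 - p) * R x B) (K : Kernel Ω Ω)
    (hK : ∀ (x : Ω) {B : Set Ω}, MeasurableSet B → K x B =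
      ∫⁻ y in B, imhAcceptE w x y ∂(R' x) + (1 - ∫⁻ y, imhAcceptE w x y ∂(R' x)) * B.indicator 1 x)
    (x : Ω) {B : Set Ω} (hB : MeasurableSet B) :
    p * (ENNReal.ofReal M)⁻¹ * (q.withDensity fun y => ENNReal.ofReal (w y)) B ≤ K x B := by
  refine le_trans ?_ (defensive_apply_ge R R' hR' K hK x hB)
  rw [mul_assoc]
  gcongr
  -- `M⁻¹ π(B) ≤ ∫_B a(x, y) q(dy)` exactly as in `IMHKernel.indepMH_apply_ge`
  have hMpos : 0 < M := (hw0 x).trans_le (hM x)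
  rw [withDensity_apply _ hB]
  calc (ENNReal.ofReal M)⁻¹ * ∫⁻ y in B, ENNReal.ofReal (w y) ∂q
        = ∫⁻ y in B, (ENNReal.ofReal M)⁻¹ * ENNReal.ofReal (w y) ∂q := by rw [lintegral_const_mul _ hw.ennreal_ofReal]
    _ = ∫⁻ y in B, ENNReal.ofReal (w y / M) ∂q := by
          refine lintegral_congr fun y => ?_
          rw [div_eq_inv_mul, ENNReal.ofReal_mul (inv_nonneg.mpr hMpos.le), ENNReal.ofReal_inv_of_pos hMpos]
    _ ≤ ∫⁻ y in B, imhAcceptE w x y ∂q := lintegral_mono fun y => imhAcceptE_ge_of_le hw0 hM x y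

/-- **UNIFORM ERGODICITY AT RATE `(1 − p/W)ᵗ`** for a normalised weight `0 < w ≤ W`, from every initial law. [ours] -/
theorem defensive_uniformlyErgodic (hw : Measurable w) (hw0 : ∀ x, 0 < w x) {W : ℝ} (hW : ∀ x, w x ≤ W) (hp : p ≤ 1)
    [IsProbabilityMeasure (q.withDensity fun y => ENNReal.ofReal (w y))] (R : Kernel Ω Ω) [IsMarkovKernel R]
    (hR : Kernel.IsReversible R q) (R' : Kernel Ω Ω)
    (hR' : ∀ (x : Ω) {B : Set Ω}, MeasurableSet B → R' x B = p * q B + (1 - p) * R x B) (K : Kernel Ω Ω)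
    (hK : ∀ (x : Ω) {B : Set Ω}, MeasurableSet B → K x B =
      ∫⁻ y in B, imhAcceptE w x y ∂(R' x) + (1 - ∫⁻ y, imhAcceptE w x y ∂(R' x)) * B.indicator 1 x)
    (μ₀ : Measure Ω) [IsProbabilityMeasure μ₀] (t : ℕ) (A : Set Ω) :
    |((fun ν : Measure Ω => ν.bind K)^[t] μ₀).real A - (q.withDensity fun y => ENNReal.ofReal (w y)).real A| ≤
      (1 - p.toReal * W⁻¹) ^ t := by
  haveI := defensive_isMarkovKernel hp R R' hR'
  haveI := revProposal_isMarkovKernel R' K hK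
  have hWpos : 0 < W := by
    obtain ⟨y⟩ := nonempty_of_isProbabilityMeasure q
    exact (hw0 y).trans_le (hW y)
  have hmin : ∀ x, (p * (ENNReal.ofReal W)⁻¹) • (q.withDensity fun y => ENNReal.ofReal (w y)) ≤ K x := fun x => by
    refine Measure.le_iff.2 fun B hB => ?_
    rw [Measure.smul_apply, smul_eq_mul]
    exact defensive_minorisation hw hw0 hW R R' hR' K hK x hB
  have h := uniformlyErgodic_of_minorised hmin (defensive_invariant hw hw0 hp R hR R' hR' K hK) μ₀ t A
  have hε : (p * (ENNReal.ofReal W)⁻¹).toReal = p.toReal * W⁻¹ := by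
    rw [ENNReal.toReal_mul, ENNReal.toReal_inv, ENNReal.toReal_ofReal hWpos.le]
  rwa [hε] at h

end Summit.Ventures.LatticeQCDFlow.Exactness
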